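import Mathlib.Algebra.Order.Field.GeomSum
import Literature.LinearAlgebra.Matrix.FiniteRangeDecompositionMatrixBounds

/-!
# Stub `stub_frPiecesSFU` of line `finite-range-heat-slices` (crux stmt-QuantumFields-18031), auxiliary analysis

Pure real analysis for the SFU power counting of the Bauerschmidt pieces `C_n = MatrixFRD.piece Q 64 2 n`
(the companion file `…StubFrPiecesSFU.lean` does the spectral transfer): §A `exists_gFun_le_majorant_four` —
the tree's `MatrixFRD.exists_gFun_le_majorant` with the FOURTH power of the `P_t`-lemma (BBS, LNM 2242,
Ch. 3) — and `inv_one_add_pow_le_sum_exp`, `(1+y)^{-s} ≤ e² Σ_{j<N} (2^j)^{-s} e^{-y/2^j}` for `1 + y < 2^N`;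
§D the scalar domination on the spectral window `0 ≤ x ≤ 81`, `0 ≤ s ≤ 1` at `Θ = 64`, `L_* = 2`:
`g_n(x+s)` and `x·g_n(x+s)` by `𝟙[n=1]` plus finite exponential sums `Σ_{j≤2n} (2^j)^{-4 or -3} e^{-t_j x}`,
`t_j = 4ⁿ/1024/2^j`.
-/

noncomputable section

namespace Summit.QuantumFields.QCD.Cruxes.InterleavedFlowProper.FiniteRangeHeatSlices

/-! ## §A Pure analysis: the `s = 4` majorant of the scale functions and discrete subordination -/

section Majorant

open MeasureTheory Set
open scoped Real FourierTransform
open Literature.Barriers.CriticalPhenomena.LongRangePhi4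
open Literature.LinearAlgebra.Matrix.MatrixFRD

/-- Large scales with the FOURTH power: for `t ≥ 1` and `μ ≥ 0`, with the constant `c₄` of the
`P_t`-lemma (`s = 4`), `ŵ_Θ(t,μ)/t ≤ (c₄/c) · t · (1 + t²·min(μ,4Θ)/Θ)^{-4} / Θ`
(BBS, LNM 2242, Ch. 3, the `P_t`-lemma, case `t ≥ 1`). -/
theorem wFun_div_le_of_one_le_four {c₄ : ℝ}
    (hc₄ : ∀ t : ℝ, 1 ≤ t → ∀ ζ ∈ Icc (0:ℝ) 4,
      |FRD.chebyProfile (fun v => (FRD.profile v).re) t ζ| ≤ c₄ * ((1 + t ^ 2 * ζ) ^ 4)⁻¹)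
    {Θ : ℝ} (hΘ : 0 < Θ) {t : ℝ} (ht : 1 ≤ t) {μ : ℝ} (hμ : 0 ≤ μ) :
    wFun Θ t μ / t ≤ c₄ / FRD.cProfile * (t * ((1 + t ^ 2 * (min μ (4 * Θ) / Θ)) ^ 4)⁻¹) / Θ := by
  -- adapted from MatrixFRD.wFun_div_le_of_one_le (exponent 3 ↦ 4)
  have hc := FRD.cProfile_pos
  have ht0 : 0 < t := by linarith
  rw [wFun_eq_wFun_min hΘ]
  set m := min μ (4 * Θ) with hm
  have hm0 : 0 ≤ m := le_min hμ (by linarith)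
  have hm4 : m / Θ ∈ Icc (0:ℝ) 4 :=
    ⟨div_nonneg hm0 hΘ.le, by rw [div_le_iff₀ hΘ]; exact min_le_right _ _⟩
  have key := (le_abs_self _).trans (hc₄ t ht (m / Θ) hm4)
  unfold wFun
  have hrew : t ^ 2 / (FRD.cProfile * Θ) *
      FRD.chebyProfile (fun v => (FRD.profile v).re) t (m / Θ) / t
      = (t / (FRD.cProfile * Θ)) * FRD.chebyProfile (fun v => (FRD.profile v).re) t (m / Θ) := by
    field_simp
  rw [hrew]
  calc t / (FRD.cProfile * Θ) * FRD.chebyProfile (fun v => (FRD.profile v).re) t (m / Θ)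
      ≤ t / (FRD.cProfile * Θ) * (c₄ * ((1 + t ^ 2 * (m / Θ)) ^ 4)⁻¹) :=
        mul_le_mul_of_nonneg_left key (by positivity)
    _ = c₄ / FRD.cProfile * (t * ((1 + t ^ 2 * (m / Θ)) ^ 4)⁻¹) / Θ := by
        field_simp

/-- **The `s = 4` antitone majorant of the scale functions**: there is `K > 0` such that for all
`Θ > 0`, `L_* ≥ 2`, `j ≥ 1`, `μ ≥ 0`, `g_j(μ) ≤ (K/Θ)·(𝟙[j=1] + (L_*^j/2)²·(1 + (L_*^{j-1}/2)²·min(μ,4Θ)/Θ)^{-4})`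
— the tree's `MatrixFRD.exists_gFun_le_majorant` with the fourth power of the `P_t`-lemma
(BBS, LNM 2242, Ch. 3, proof of (3.11): integration of the `w`-bound over one scale). -/
theorem exists_gFun_le_majorant_four :
    ∃ K : ℝ, 0 < K ∧ ∀ Θ : ℝ, 0 < Θ → ∀ L : ℝ, 2 ≤ L → ∀ j : ℕ, 1 ≤ j → ∀ μ : ℝ, 0 ≤ μ →
      gFun Θ L j μ ≤ K / Θ * ((if j = 1 then (1:ℝ) else 0) +
        (L ^ j / 2) ^ 2 * ((1 + (L ^ (j - 1) / 2) ^ 2 * (min μ (4 * Θ) / Θ)) ^ 4)⁻¹) := by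
  -- adapted from MatrixFRD.exists_gFun_le_majorant (exponent 3 ↦ 4)
  obtain ⟨c₄, hc₄pos, hc₄⟩ := FRD.abs_chebyProfile_profile_le (s := 4) (by norm_num)
  have hc := FRD.cProfile_pos
  set α : ℝ := |(𝓕 (FRD.profile : ℝ → ℂ) 0).re| / (2 * π * FRD.cProfile) with hα
  have hα0 : 0 ≤ α := by positivity
  refine ⟨α + c₄ / FRD.cProfile, by positivity, fun Θ hΘ L hL j hj μ hμ => ?_⟩
  set K : ℝ := α + c₄ / FRD.cProfile with hK
  have hK1 : α ≤ K := by simp [hK]; positivity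
  have hK2 : c₄ / FRD.cProfile ≤ K := by simp [hK, hα0]
  set m := min μ (4 * Θ) with hm
  have hm0 : 0 ≤ m := le_min hμ (by linarith)
  set a : ℝ := L ^ (j - 1) / 2 with ha
  set b : ℝ := L ^ j / 2 with hb
  set q : ℝ := ((1 + a ^ 2 * (m / Θ)) ^ 4)⁻¹ with hq
  have hL0 : 0 ≤ L := by linarith
  have ha0 : 0 < a := by positivity
  have hb1 : 1 ≤ b := by
    rw [hb, le_div_iff₀ (by norm_num : (0:ℝ) < 2)]
    calc (1 : ℝ) * 2 = 2 ^ 1 := by norm_num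
      _ ≤ 2 ^ j := pow_le_pow_right₀ (by norm_num) hj
      _ ≤ L ^ j := pow_le_pow_left₀ (by norm_num) hL j
  have hq0 : 0 ≤ q := by positivity
  have hsb : scaleEnd L j = b := scaleEnd_of_ne_zero L (by omega)
  set s₀ : ℝ := scaleEnd L (j - 1) with hs₀
  have hs₀0 : 0 ≤ s₀ := scaleEnd_nonneg hL0 _
  have hs₀a : j ≠ 1 → s₀ = a := fun hj1 => by
    rw [hs₀, scaleEnd_of_ne_zero L (by omega), ha]
  have hpt : ∀ t ∈ Ioc s₀ b, wFun Θ t μ / t ≤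
      K / Θ * (Set.indicator (Iio (1:ℝ)) (fun _ => (1:ℝ)) t + b * q) := by
    intro t ht
    have ht0 : 0 < t := hs₀0.trans_lt ht.1
    by_cases h1 : t < 1
    · rw [Set.indicator_of_mem (show t ∈ Iio (1:ℝ) from h1)]
      calc wFun Θ t μ / t ≤ α / Θ := wFun_div_le_of_lt_one hΘ ht0 h1 μ
        _ ≤ K / Θ * (1 + b * q) := by
            rw [div_eq_mul_inv, div_eq_mul_inv]
            have : α * Θ⁻¹ ≤ K * Θ⁻¹ := mul_le_mul_of_nonneg_right hK1 (by positivity)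
            refine this.trans ?_
            have h1bq : (1:ℝ) ≤ 1 + b * q := by
              nlinarith [mul_nonneg (by linarith : (0:ℝ) ≤ b) hq0]
            calc K * Θ⁻¹ = K * Θ⁻¹ * 1 := by ring
              _ ≤ K * Θ⁻¹ * (1 + b * q) := mul_le_mul_of_nonneg_left h1bq (by positivity)
    · have ht1 : 1 ≤ t := not_lt.mp h1
      rw [Set.indicator_of_notMem (show t ∉ Iio (1:ℝ) from h1), zero_add]
      have hat : a ≤ t := by
        by_cases hj1 : j = 1
        · subst hj1
          have : a = 1 / 2 := by rw [ha]; norm_num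
          linarith
        · rw [← hs₀a hj1]; exact ht.1.le
      calc wFun Θ t μ / t
          ≤ c₄ / FRD.cProfile * (t * ((1 + t ^ 2 * (min μ (4 * Θ) / Θ)) ^ 4)⁻¹) / Θ :=
            wFun_div_le_of_one_le_four hc₄ hΘ ht1 hμ
        _ ≤ K * (b * q) / Θ := by
            rw [← hm]
            have hqt : ((1 + t ^ 2 * (m / Θ)) ^ 4)⁻¹ ≤ q := by
              rw [hq]
              apply inv_anti₀ (by positivity)
              gcongr
            have htq : t * ((1 + t ^ 2 * (m / Θ)) ^ 4)⁻¹ ≤ b * q :=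
              mul_le_mul ht.2 hqt (by positivity) (by linarith)
            have := mul_le_mul hK2 htq (by positivity) (by positivity)
            exact div_le_div_of_nonneg_right this hΘ.le
        _ = K / Θ * (b * q) := by ring
  have hmeas : MeasurableSet (Ioc s₀ b) := measurableSet_Ioc
  have hIf : IntegrableOn (fun t => wFun Θ t μ / t) (Ioc s₀ b) := by
    have h := integrableOn_wFun_div_Ioc hΘ hm0 (min_le_right μ (4 * Θ)) hs₀0 b
    refine h.congr_fun (fun t _ => ?_) measurableSet_Ioc
    exact (congrArg (· / t) (wFun_eq_wFun_min hΘ t μ)).symm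
  have hIg : IntegrableOn
      (fun t => K / Θ * (Set.indicator (Iio (1:ℝ)) (fun _ => (1:ℝ)) t + b * q)) (Ioc s₀ b) := by
    refine Integrable.const_mul (Integrable.add ?_ (integrableOn_const (by simp))) _
    exact (integrableOn_const (by simp)).indicator measurableSet_Iio
  have hmono := setIntegral_mono_on hIf hIg hmeas hpt
  unfold gFun
  rw [hsb]
  refine hmono.trans ?_
  rw [integral_const_mul]
  refine mul_le_mul_of_nonneg_left ?_ (by positivity)
  have hI1 : IntegrableOn (fun t => Set.indicator (Iio (1:ℝ)) (fun _ => (1:ℝ)) t) (Ioc s₀ b) :=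
    (integrableOn_const (by simp)).indicator measurableSet_Iio
  have hI2 : IntegrableOn (fun _ : ℝ => b * q) (Ioc s₀ b) := integrableOn_const (by simp)
  rw [integral_add hI1 hI2, setIntegral_const, smul_eq_mul]
  have hind : ∫ t in Ioc s₀ b, Set.indicator (Iio (1:ℝ)) (fun _ => (1:ℝ)) t ≤
      (if j = 1 then (1:ℝ) else 0) := by
    rw [setIntegral_indicator measurableSet_Iio, setIntegral_const, smul_eq_mul, mul_one,
      measureReal_def]
    by_cases hj1 : j = 1
    · rw [if_pos hj1]
      have hsub : Ioc s₀ b ∩ Iio 1 ⊆ Ioc s₀ (max s₀ 1) := by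
        intro t ht
        exact ⟨ht.1.1, le_max_of_le_right (le_of_lt ht.2)⟩
      calc (volume (Ioc s₀ b ∩ Iio 1)).toReal ≤ (volume (Ioc s₀ (max s₀ 1))).toReal := by
            exact ENNReal.toReal_mono (by simp) (measure_mono hsub)
        _ ≤ 1 := by
            rw [Real.volume_Ioc, ENNReal.toReal_ofReal (by simp)]
            rcases le_total s₀ 1 with h | h
            · rw [max_eq_right h]; linarith
            · rw [max_eq_left h]; linarith
    · rw [if_neg hj1]
      have ha1 : 1 ≤ a := by
        rw [ha, le_div_iff₀ (by norm_num : (0:ℝ) < 2)]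
        have hj2 : 1 ≤ j - 1 := by omega
        calc (1:ℝ) * 2 = 2 ^ 1 := by norm_num
          _ ≤ 2 ^ (j - 1) := pow_le_pow_right₀ (by norm_num) hj2
          _ ≤ L ^ (j - 1) := pow_le_pow_left₀ (by norm_num) hL _
      have hempty : Ioc s₀ b ∩ Iio 1 = ∅ := by
        ext t
        simp only [Set.mem_inter_iff, Set.mem_Ioc, Set.mem_Iio, Set.mem_empty_iff_false, iff_false,
          not_and, not_lt, and_imp]
        intro h1 _
        rw [hs₀a hj1] at h1
        linarith
      rw [hempty, measure_empty, ENNReal.toReal_zero]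
  have hconst : volume.real (Ioc s₀ b) * (b * q) ≤ b ^ 2 * q := by
    rw [measureReal_def]
    by_cases hle : s₀ ≤ b
    · rw [Real.volume_Ioc, ENNReal.toReal_ofReal (by linarith)]
      have : (b - s₀) * (b * q) ≤ b * (b * q) :=
        mul_le_mul_of_nonneg_right (by linarith) (by positivity)
      nlinarith
    · push Not at hle
      rw [Ioc_eq_empty (by linarith), measure_empty, ENNReal.toReal_zero, zero_mul]
      positivity
  have hb2 : (L ^ j / 2) ^ 2 = b ^ 2 := by rw [hb]
  rw [hb2]
  exact add_le_add hind hconst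

/-- **Registered anchor of this auxiliary file** (sub-goal `stub_frPiecesSFUMajorantFour` of crux
stmt-QuantumFields-18031, serving `stub_frPiecesSFU`): the `s = 4` majorant of the Bauerschmidt scale
functions, verbatim `exists_gFun_le_majorant_four` with the tree's `gFun` fully qualified. -/
theorem stub_frPiecesSFUMajorantFour :
    ∃ K : ℝ, 0 < K ∧ ∀ Θ : ℝ, 0 < Θ → ∀ L : ℝ, 2 ≤ L → ∀ j : ℕ, 1 ≤ j → ∀ μ : ℝ, 0 ≤ μ →
      Literature.LinearAlgebra.Matrix.MatrixFRD.gFun Θ L j μ ≤ K / Θ * ((if j = 1 then (1:ℝ) else 0) +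
        (L ^ j / 2) ^ 2 * ((1 + (L ^ (j - 1) / 2) ^ 2 * (min μ (4 * Θ) / Θ)) ^ 4)⁻¹) :=
  exists_gFun_le_majorant_four

/-- **Discrete subordination of a power to exponentials**: for `s, N ∈ ℕ` and `0 ≤ y` with
`1 + y < 2^N`, `(1 + y)^{-s} ≤ e² Σ_{j<N} (2^j)^{-s} e^{-y/2^j}` — the single term `j = ⌊log₂(1+y)⌋`
(`2^j ≤ 1 + y < 2^{j+1}`, so `(1+y)^{-s} ≤ 2^{-sj}` and `y/2^j < 2`) already dominates. [folklore] -/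
theorem inv_one_add_pow_le_sum_exp (s N : ℕ) {y : ℝ} (hy : 0 ≤ y) (hN : 1 + y < (2:ℝ) ^ N) :
    ((1 + y) ^ s)⁻¹ ≤
      Real.exp 2 * ∑ j ∈ Finset.range N, (((2:ℝ) ^ j) ^ s)⁻¹ * Real.exp (-(y / (2:ℝ) ^ j)) := by
  set j : ℕ := Nat.log 2 ⌊1 + y⌋₊ with hj
  have h1y : 0 ≤ 1 + y := by linarith
  have hfloor1 : ⌊1 + y⌋₊ ≠ 0 :=
    Nat.one_le_iff_ne_zero.mp ((Nat.le_floor_iff h1y).mpr (by push_cast; linarith))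
  have hpow_le : 2 ^ j ≤ ⌊1 + y⌋₊ := Nat.pow_log_le_self 2 hfloor1
  have hlt_pow : ⌊1 + y⌋₊ < 2 ^ (j + 1) := Nat.lt_pow_succ_log_self (by norm_num : 1 < 2) _
  have hjy : (2:ℝ) ^ j ≤ 1 + y :=
    (by exact_mod_cast hpow_le : (2:ℝ) ^ j ≤ ⌊1 + y⌋₊).trans (Nat.floor_le h1y)
  have hyj : 1 + y < (2:ℝ) ^ (j + 1) := by
    have h1 : ((⌊1 + y⌋₊ : ℕ) : ℝ) + 1 ≤ (2:ℝ) ^ (j + 1) := by exact_mod_cast hlt_pow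
    exact (Nat.lt_floor_add_one (1 + y)).trans_le h1
  have hjN : j < N := by
    by_contra h
    linarith [pow_le_pow_right₀ (by norm_num : (1:ℝ) ≤ 2) (not_lt.mp h)]
  have h2j : (0:ℝ) < 2 ^ j := by positivity
  have hterm : ((1 + y) ^ s)⁻¹ ≤
      Real.exp 2 * ((((2:ℝ) ^ j) ^ s)⁻¹ * Real.exp (-(y / (2:ℝ) ^ j))) := by
    have hA : ((1 + y) ^ s)⁻¹ ≤ (((2:ℝ) ^ j) ^ s)⁻¹ := by
      apply inv_anti₀ (by positivity)
      exact pow_le_pow_left₀ h2j.le hjy s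
    have hB : 1 ≤ Real.exp 2 * Real.exp (-(y / (2:ℝ) ^ j)) := by
      rw [← Real.exp_add]
      apply Real.one_le_exp
      have : y / (2:ℝ) ^ j ≤ 2 := by rw [div_le_iff₀ h2j, ← pow_succ']; linarith
      linarith
    calc ((1 + y) ^ s)⁻¹ ≤ (((2:ℝ) ^ j) ^ s)⁻¹ * 1 := by rw [mul_one]; exact hA
      _ ≤ (((2:ℝ) ^ j) ^ s)⁻¹ * (Real.exp 2 * Real.exp (-(y / (2:ℝ) ^ j))) :=
          mul_le_mul_of_nonneg_left hB (by positivity)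
      _ = _ := by ring
  refine hterm.trans ?_
  rw [Finset.mul_sum]
  exact Finset.single_le_sum
    (f := fun j => Real.exp 2 * ((((2:ℝ) ^ j) ^ s)⁻¹ * Real.exp (-(y / (2:ℝ) ^ j))))
    (fun i _ => by positivity) (Finset.mem_range.mpr hjN)

/-- Geometric tail `Σ_{j<N} (2^j)^{-2} ≤ 4/3`. [folklore] -/
theorem sum_inv_pow_two_sq_le (N : ℕ) : ∑ j ∈ Finset.range N, (((2:ℝ) ^ j) ^ 2)⁻¹ ≤ 4 / 3 := by
  have h : ∀ j : ℕ, (((2:ℝ) ^ j) ^ 2)⁻¹ = (1 / 4 : ℝ) ^ j := fun j => by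
    rw [← pow_mul, mul_comm, pow_mul, ← inv_pow]; norm_num
  simp_rw [h, Finset.range_eq_Ico]
  refine (geom_sum_Ico_le_of_lt_one (by norm_num) (by norm_num)).trans ?_
  norm_num

/-- Geometric tail `Σ_{j<N} (2^j)^{-1} ≤ 2`. [folklore] -/
theorem sum_inv_pow_two_le (N : ℕ) : ∑ j ∈ Finset.range N, ((2:ℝ) ^ j)⁻¹ ≤ 2 := by
  have h : ∀ j : ℕ, ((2:ℝ) ^ j)⁻¹ = (1 / 2 : ℝ) ^ j := fun j => by rw [← inv_pow]; norm_num
  simp_rw [h, Finset.range_eq_Ico]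
  refine (geom_sum_Ico_le_of_lt_one (by norm_num) (by norm_num)).trans ?_
  norm_num

end Majorant

/-! ## §D Scalar domination on the spectral window `[0, 81] + μ²`, `Θ = 64`, `L_* = 2` -/

section Scalar

open Literature.LinearAlgebra.Matrix.MatrixFRD

/-- `g_0 = 0`: the zeroth scale interval `(s_0, s_0]` is empty. [folklore] -/
theorem gFun_zero (Θ L ν : ℝ) : gFun Θ L 0 ν = 0 := by
  unfold gFun
  rw [Nat.zero_sub, scaleEnd_zero, Set.Ioc_self, MeasureTheory.setIntegral_empty]

/-- The `s = 4` majorant at `Θ = 64`, `L_* = 2` on the window: for `0 ≤ x`, `0 ≤ s`, `x + s ≤ 256`,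
`g_n(x + s) ≤ (K/64)𝟙[n=1] + (K/256)·4ⁿ·(1 + 4ⁿx/1024)^{-4}` (drop `s ≥ 0` by antitonicity;
`n = 0` is the empty piece). -/
theorem gFun_shift_le {K : ℝ} (hK : 0 ≤ K)
    (hmaj : ∀ Θ : ℝ, 0 < Θ → ∀ L : ℝ, 2 ≤ L → ∀ j : ℕ, 1 ≤ j → ∀ μ : ℝ, 0 ≤ μ →
      gFun Θ L j μ ≤ K / Θ * ((if j = 1 then (1:ℝ) else 0) +
        (L ^ j / 2) ^ 2 * ((1 + (L ^ (j - 1) / 2) ^ 2 * (min μ (4 * Θ) / Θ)) ^ 4)⁻¹))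
    (n : ℕ) {x s : ℝ} (hx : 0 ≤ x) (hs : 0 ≤ s) (hxs : x + s ≤ 256) :
    gFun 64 2 n (x + s) ≤ K / 64 * (if n = 1 then (1:ℝ) else 0) +
      K / 256 * 4 ^ n * ((1 + 4 ^ n / 1024 * x) ^ 4)⁻¹ := by
  rcases n with _ | m
  · rw [gFun_zero, if_neg (by omega)]
    positivity
  · have h := hmaj 64 (by norm_num) 2 le_rfl (m + 1) (by omega) (x + s) (by linarith)
    have hmin : min (x + s) (4 * 64) = x + s := min_eq_left (by linarith)
    have h2 : ((2:ℝ) ^ (m + 1) / 2) ^ 2 = 4 ^ m := by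
      rw [pow_succ (2:ℝ) m, mul_div_cancel_right₀ _ two_ne_zero, ← pow_mul, pow_mul']
      norm_num
    have ha : ((2:ℝ) ^ (m + 1 - 1) / 2) ^ 2 * ((x + s) / 64) = 4 ^ m / 256 * (x + s) := by
      rw [Nat.add_sub_cancel, div_pow, show ((2:ℝ) ^ m) ^ 2 = 4 ^ m by rw [← pow_mul, pow_mul']; norm_num]
      ring
    rw [hmin, h2, ha] at h
    have hq : ((1 + 4 ^ m / 256 * (x + s)) ^ 4)⁻¹ ≤ ((1 + 4 ^ (m + 1) / 1024 * x) ^ 4)⁻¹ := by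
      apply inv_anti₀ (by positivity)
      apply pow_le_pow_left₀ (by positivity)
      have : (4:ℝ) ^ (m + 1) / 1024 * x = 4 ^ m / 256 * x := by rw [pow_succ]; ring
      rw [this]
      have : (4:ℝ) ^ m / 256 * x ≤ 4 ^ m / 256 * (x + s) :=
        mul_le_mul_of_nonneg_left (by linarith) (by positivity)
      linarith
    calc gFun 64 2 (m + 1) (x + s) ≤ _ := h
      _ = K / 64 * (if m + 1 = 1 then (1:ℝ) else 0) +
            K / 256 * 4 ^ (m + 1) * ((1 + 4 ^ m / 256 * (x + s)) ^ 4)⁻¹ := by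
          rw [pow_succ]; ring
      _ ≤ _ := by gcongr

/-- **Scalar domination for the diagonal claim**: on `0 ≤ x ≤ 81`, `0 ≤ s ≤ 1`,
`g_n(x + s) ≤ (K/64)𝟙[n=1] + e²(K/256)4ⁿ Σ_{j ≤ 2n} (2^j)^{-4} e^{-t_j x}`, `t_j = 4ⁿ/1024/2^j`
(the `s = 4` majorant subordinated to exponentials). -/
theorem scalar_diag_le {K : ℝ} (hK : 0 ≤ K)
    (hmaj : ∀ Θ : ℝ, 0 < Θ → ∀ L : ℝ, 2 ≤ L → ∀ j : ℕ, 1 ≤ j → ∀ μ : ℝ, 0 ≤ μ →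
      gFun Θ L j μ ≤ K / Θ * ((if j = 1 then (1:ℝ) else 0) +
        (L ^ j / 2) ^ 2 * ((1 + (L ^ (j - 1) / 2) ^ 2 * (min μ (4 * Θ) / Θ)) ^ 4)⁻¹))
    (n : ℕ) {x s : ℝ} (hx : 0 ≤ x) (hx81 : x ≤ 81) (hs : 0 ≤ s) (hs1 : s ≤ 1) :
    gFun 64 2 n (x + s) ≤ K / 64 * (if n = 1 then (1:ℝ) else 0) +
      Real.exp 2 * (K / 256) * 4 ^ n * ∑ j ∈ Finset.range (2 * n + 1),
        (((2:ℝ) ^ j) ^ 4)⁻¹ * Real.exp (-(4 ^ n / 1024 / 2 ^ j * x)) := by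
  have h1 := gFun_shift_le hK hmaj n hx hs (by linarith)
  have h4pos : (0:ℝ) < 4 ^ n := by positivity
  have hy0 : 0 ≤ (4:ℝ) ^ n / 1024 * x := by positivity
  have hyN : 1 + (4:ℝ) ^ n / 1024 * x < (2:ℝ) ^ (2 * n + 1) := by
    have h4 : (2:ℝ) ^ (2 * n + 1) = 4 ^ n * 2 := by rw [pow_succ, pow_mul]; norm_num
    have h1le : (1:ℝ) ≤ 4 ^ n := one_le_pow₀ (by norm_num)
    have : (4:ℝ) ^ n / 1024 * x ≤ 4 ^ n / 1024 * 81 :=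
      mul_le_mul_of_nonneg_left hx81 (by positivity)
    rw [h4]
    nlinarith
  have h2 := inv_one_add_pow_le_sum_exp 4 (2 * n + 1) hy0 hyN
  have h3 : ∀ j : ℕ, Real.exp (-((4:ℝ) ^ n / 1024 * x / 2 ^ j)) =
      Real.exp (-(4 ^ n / 1024 / 2 ^ j * x)) := fun j => by
    congr 1; ring
  simp_rw [h3] at h2
  have hb : 0 ≤ K / 256 * 4 ^ n := by positivity
  have h4 := mul_le_mul_of_nonneg_left h2 hb
  linarith

/-- **Scalar domination for the sandwiched claim**: on `0 ≤ x ≤ 81`, `0 ≤ s ≤ 1`,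
`x·g_n(x + s) ≤ 81(K/64)𝟙[n=1] + 4e²K Σ_{j ≤ 2n} (2^j)^{-3} e^{-t_j x}` (one power of the
majorant absorbs the factor `x`: `y(1+y)^{-4} ≤ (1+y)^{-3}`; then subordination with `s = 3`). -/
theorem scalar_sand_le {K : ℝ} (hK : 0 ≤ K)
    (hmaj : ∀ Θ : ℝ, 0 < Θ → ∀ L : ℝ, 2 ≤ L → ∀ j : ℕ, 1 ≤ j → ∀ μ : ℝ, 0 ≤ μ →
      gFun Θ L j μ ≤ K / Θ * ((if j = 1 then (1:ℝ) else 0) +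
        (L ^ j / 2) ^ 2 * ((1 + (L ^ (j - 1) / 2) ^ 2 * (min μ (4 * Θ) / Θ)) ^ 4)⁻¹))
    (n : ℕ) {x s : ℝ} (hx : 0 ≤ x) (hx81 : x ≤ 81) (hs : 0 ≤ s) (hs1 : s ≤ 1) :
    x * gFun 64 2 n (x + s) ≤ 81 * (K / 64 * (if n = 1 then (1:ℝ) else 0)) +
      Real.exp 2 * (4 * K) * ∑ j ∈ Finset.range (2 * n + 1),
        (((2:ℝ) ^ j) ^ 3)⁻¹ * Real.exp (-(4 ^ n / 1024 / 2 ^ j * x)) := by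
  have h1 := gFun_shift_le hK hmaj n hx hs (by linarith)
  have h4pos : (0:ℝ) < 4 ^ n := by positivity
  set y : ℝ := (4:ℝ) ^ n / 1024 * x with hy
  have hy0 : 0 ≤ y := by positivity
  have hyN : 1 + y < (2:ℝ) ^ (2 * n + 1) := by
    have h4 : (2:ℝ) ^ (2 * n + 1) = 4 ^ n * 2 := by rw [pow_succ, pow_mul]; norm_num
    have h1le : (1:ℝ) ≤ 4 ^ n := one_le_pow₀ (by norm_num)
    have : (4:ℝ) ^ n / 1024 * x ≤ 4 ^ n / 1024 * 81 :=
      mul_le_mul_of_nonneg_left hx81 (by positivity)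
    rw [h4]
    nlinarith
  have h2 := inv_one_add_pow_le_sum_exp 3 (2 * n + 1) hy0 hyN
  have h3 : ∀ j : ℕ, Real.exp (-(y / 2 ^ j)) = Real.exp (-(4 ^ n / 1024 / 2 ^ j * x)) := fun j => by
    rw [hy]; congr 1; ring
  simp_rw [h3] at h2
  have hkey : y * ((1 + y) ^ 4)⁻¹ ≤ ((1 + y) ^ 3)⁻¹ := by
    have h1y : 0 < 1 + y := by linarith
    rw [show (1 + y) ^ 4 = (1 + y) ^ 3 * (1 + y) by ring, mul_inv,
      show y * (((1 + y) ^ 3)⁻¹ * (1 + y)⁻¹) = (y / (1 + y)) * ((1 + y) ^ 3)⁻¹ by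
        rw [div_eq_mul_inv]; ring]
    exact mul_le_of_le_one_left (by positivity) ((div_le_one h1y).mpr (by linarith))
  have hind0 : 0 ≤ K / 64 * (if n = 1 then (1:ℝ) else 0) := by
    have : 0 ≤ (if n = 1 then (1:ℝ) else 0) := by split_ifs <;> norm_num
    positivity
  have hxg := mul_le_mul_of_nonneg_left h1 hx
  have hxa : x * (K / 64 * (if n = 1 then (1:ℝ) else 0)) ≤
      81 * (K / 64 * (if n = 1 then (1:ℝ) else 0)) := mul_le_mul_of_nonneg_right hx81 hind0
  have hxb : x * (K / 256 * 4 ^ n * ((1 + y) ^ 4)⁻¹) = 4 * K * (y * ((1 + y) ^ 4)⁻¹) := by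
    rw [hy]; ring
  have hK4 : 0 ≤ 4 * K := by positivity
  have h5 := mul_le_mul_of_nonneg_left (hkey.trans h2) hK4
  calc x * gFun 64 2 n (x + s)
      ≤ x * (K / 64 * (if n = 1 then (1:ℝ) else 0)) +
          x * (K / 256 * 4 ^ n * ((1 + y) ^ 4)⁻¹) := by rw [← mul_add]; exact hxg
    _ ≤ 81 * (K / 64 * (if n = 1 then (1:ℝ) else 0)) + 4 * K * (y * ((1 + y) ^ 4)⁻¹) := by
        rw [hxb]; exact add_le_add hxa le_rfl
    _ ≤ _ := by linarith

end Scalar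

end Summit.QuantumFields.QCD.Cruxes.InterleavedFlowProper.FiniteRangeHeatSlices

end
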